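import Summits.HubbardSuperconductivity.HubbardLadder.Bounds.ThermalAttractiveKineticCeiling

/-!
# Hubbard ladder — Bounds: the density-proportional attractive stiffness ceilings at `T > 0`
# (bounds.tex Thm 9(iii) and Thm 9(vi) at `T > 0`, `t–t'` class, typed AND proved)

HONEST FRAMING (cell pub-hubbard): ladder R1–R4 with certified numbers; no claim on H/H₀. These
are bounds for a MODEL CLASS — the attractive `t–t'` Hubbard torus `hubbardTorusTT' L 1 t' U`
(`t = 1`, any real `t'`, `U < 0`, torus `(ℤ/Lℤ)²`, `L ≥ 3`) in the canonical `(N_L, S^z = 0)`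
Gibbs state at `β > 0`, for a stiffness DEFINED from the flux response of the sector free energy;
no materials claim. Companion text: `pub-hubbard/paper/bounds.tex` §Theorem 9; tables
`pub-hubbard/pub-hubbard-bounds/BOUNDS.md` (row T7) and `EXTREMISERS.md` §5b.

## What is proved (no `sorry`, no new axioms), `τ := 1 + |t'|`, `N_p := dim` of the sector

* `two_mul_re_gibbsState_kinOpTT'_le` — rotation averaging: on every coordinate sector `p`
  respected by the rotation `Γ(r)`, `2 Re⟨K_{t'}|_p⟩_{β,p} ≤ -Re⟨H^{t,2t'}(0)|_p⟩_{β,p}`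
  (`K_{t'} = kinOpTT' L t'`, form `2(K_x + t'K_d)`): the form of
  `K_{t'} + Γ K_{t'} Γᴴ + H^{t,2t'}(0)` vanishes identically; Gibbs positivity and
  `⟨(Γ K Γᴴ)|_p⟩ = ⟨K|_p⟩` (`gibbsState_toBlock_conj_of_sector`).
* `hubbardTorusTT'_eq_add_smul_diagHop` — `H^{t,t''}(U) = H^{t,t'}(U) + (t'' - t') T_d`,
  `T_d = hamiltonian (fermionTorusDiagGraph L) 1 0` the unit diagonal hopping operator.
* `neg_mul_re_gibbsState_diagHop_le` — **the thermal diagonal chord**: for every real `s`,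
  `-s Re⟨T_d|_p⟩_{β,p} ≤ 64 (1 + |t' + s|)² m/|U| + (log N_p)/β` (Peierls–Bogoliubov in the
  direction `s T_d`, `log Z_p(H) ≥ -βUm` (paired trial configuration), and
  `log Z_p(H^{t,t'+s}) ≤ log N_p - β(Um - 64τ'²m/|U|)`: entropy `≤ log N_p` and the
  pair-breaking floor of Thm 9(i) as a block operator inequality at `a' = |U|/(8τ')`).
* `neg_tPrime_mul_re_gibbsState_diagHop_le` — `s = ±τ` (`τ' = 2τ`):
  `-t' Re⟨T_d|_p⟩_{β,p} ≤ |t'| (256 τ m/|U| + (log N_p)/(τβ))`.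
* `thermalStiffness_mul_sq_le_attractive_density` — **Thm 9(vi) at `T > 0`** (`L ≥ 3`, `U < 0`,
  `β > 0`, `m ≤ L²`, `p` the `(2m, S^z = 0)` sector): if the sector free energy of
  `hubbardTorusTT'Flux L t' U θ` is stiff in the flux, `β ρ_s θ² ≤ log Z_p(0) - log Z_p(θ)` on
  `|θ| ≤ θ₀`, then `ρ_s L² ≤ 64 τ(1 + 2|t'|) m/|U| + (1 + 2|t'|)(log N_p)/(4τβ)`: the landed
  thermal f-sum floor `thermalStiffnessTT'_mul_sq_le_kinetic` (`ρ_s L² ≤ ½ Re⟨K_{t'}|_p⟩`),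
  rotation averaging, `-H^{t,2t'}(0) = -H^{t,t'}(0) - t' T_d`, the thermal kinetic ceiling
  `neg_re_gibbsState_hopping_le_attractive_density` (Thm 9(v)) and the diagonal chord.
* `ThermalAttractiveStiffnessCeilingDensityTT'` / `…_holds` — the display as a node in the
  `δ`-form of the other stiffness nodes (`N_L = 2⌊(1-δ)L²/2⌋`, `δ ≥ -1`); at `T → 0` it is the
  landed Thm 9(vi) (`AttractiveStiffnessCeilingDensityTT'`); at `t' = 0` it reads
  `ρ_s L² ≤ 64 ⌊(1-δ)L²/2⌋/|U| + (log N_p)/(4β)` (**Thm 9(iii) at `T > 0`**, node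
  `ThermalAttractiveStiffnessCeilingDensity` / `…_holds`).

Honest numbers: `log N_p ≤ 2L² log 2`, so the thermal term is `≤ (1+2|t'|) T (log 2)/(2τ)` per
site; informative only in the dilute BEC corner at `T ≲ t²/|U|`, constant loose by more than an
order of magnitude (as at `T = 0`); the content is the CLASS and the form `O(n t²/|U|) + O(T)`.

References (`lean/references.bib`): ScalapinoWhiteZhang1993 §II; ParamekantiTrivediRanderia1998
eq. (3), §IV; HazraVermaRanderia2019 §III, App. G; XuEtAl2024 eq. (1);
MicnasRanningerRobaszkiewicz1990 §IV; Tasaki2020 §2.1.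
-/

noncomputable section

namespace Summit.HubbardSuperconductivity.HubbardLadder.Bounds

open Matrix Finset Real
open Literature.MathematicalPhysics.QuantumLattice
open Literature.MathematicalPhysics.QuantumFieldTheory
open Literature.Probability.LatticeModels
open scoped ComplexOrder ComplexConjugate

variable {L : ℕ} [NeZero L]

/-! ### Rotation averaging in a sector Gibbs state -/

/-- **Rotation averaging** (`L ≥ 3`, `K_{t'} = kinOpTT' L t'`, form `2(K_x + t'K_d)`): on every
coordinate sector `p` respected by the rotation `Γ(r)`,
`2 Re⟨K_{t'}|_p⟩_{β,p} ≤ -Re⟨H^{t,2t'}(0)|_p⟩_{β,p}` — the form of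
`K_{t'} + Γ K_{t'} Γᴴ + H^{t,2t'}(0)` vanishes identically, so `-(…)|_p ≥ 0`; Gibbs positivity
and `⟨(Γ K Γᴴ)|_p⟩ = ⟨K|_p⟩` (`gibbsState_toBlock_conj_of_sector`). -/
theorem two_mul_re_gibbsState_kinOpTT'_le (hL : 3 ≤ L) (t' U β : ℝ)
    (p : Finset (Orb (FermionTorus 2 L)) → Prop) [DecidablePred p] [Nonempty {a // p a}]
    (hpΓ : ∀ s t, fockMapOp (d4Orb (DihedralGroup.r 1 : DihedralGroup 4)) s t ≠ 0 → (p s ↔ p t)) :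
    2 * (gibbsState β ((hubbardTorusTT' L 1 t' U).toBlock p p) ((kinOpTT' L t').toBlock p p)).re ≤
      -(gibbsState β ((hubbardTorusTT' L 1 t' U).toBlock p p)
        ((hubbardTorusTT' L 1 (2 * t') 0).toBlock p p)).re := by
  have hHp : ((hubbardTorusTT' L 1 t' U).toBlock p p).IsHermitian :=
    (hubbardTorusTT'_isHermitian L 1 t' U).submatrix _
  set M : Matrix (Finset (Orb (FermionTorus 2 L))) (Finset (Orb (FermionTorus 2 L))) ℂ :=
    -(kinOpTT' L t' + fockMapOp (d4Orb (DihedralGroup.r 1 : DihedralGroup 4)) * kinOpTT' L t' *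
        (fockMapOp (d4Orb (DihedralGroup.r 1 : DihedralGroup 4)))ᴴ +
        hubbardTorusTT' L 1 (2 * t') 0) with hM
  have hMh : M.IsHermitian :=
    (((isHermitian_kinOpTT' t').add
      (isHermitian_mul_mul_conjTranspose _ (isHermitian_kinOpTT' t'))).add
        (hubbardTorusTT'_isHermitian L 1 (2 * t') 0)).neg
  have hMpsd : M.PosSemidef := by
    refine PosSemidef.of_dotProduct_mulVec_nonneg hMh fun φ => ?_
    have hre : (star φ ⬝ᵥ M *ᵥ φ).re = 0 := by
      rw [hM, neg_mulVec, dotProduct_neg, Complex.neg_re, add_mulVec, add_mulVec, dotProduct_add,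
        dotProduct_add, Complex.add_re, Complex.add_re, re_kinOpTT'_form, re_rot_kinOpTT'_form,
        re_expect_hubbardTorusTT'_eq_kin hL (2 * t') 0 φ]
      ring
    exact Complex.nonneg_iff.2 ⟨hre.symm.le, (hMh.im_star_dotProduct_mulVec_self φ).symm⟩
  have h0 := gibbsState_nonneg_of_posSemidef β hHp (hMpsd.submatrix (Subtype.val : {a // p a} → _))
  have hexp : M.toBlock p p = -((kinOpTT' L t').toBlock p p +
      (fockMapOp (d4Orb (DihedralGroup.r 1 : DihedralGroup 4)) * kinOpTT' L t' *
        (fockMapOp (d4Orb (DihedralGroup.r 1 : DihedralGroup 4)))ᴴ).toBlock p p +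
      (hubbardTorusTT' L 1 (2 * t') 0).toBlock p p) := by
    ext i j
    rfl
  have hrot := gibbsState_toBlock_conj_of_sector p hpΓ fockMapOp_rot_mul_conjTranspose
    (fockMapOp_rot_mul_hubbardTorusTT' 1 t' U) β (kinOpTT' L t')
  change 0 ≤ gibbsState β ((hubbardTorusTT' L 1 t' U).toBlock p p) (M.toBlock p p) at h0
  rw [hexp, map_neg, map_add, map_add, hrot] at h0
  have h1 := (Complex.nonneg_iff.1 h0).1
  simp only [Complex.neg_re, Complex.add_re] at h1
  linarith

/-! ### The thermal diagonal chord -/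

/-- The hopping Hamiltonian is linear in the hopping amplitude: `H_G(s, 0) = s · H_G(1, 0)`. -/
theorem hamiltonian_zero_eq_smul {Λ : Type*} [Fintype Λ] [LinearOrder Λ] (G : SimpleGraph Λ)
    [DecidableRel G.Adj] (s : ℝ) : hamiltonian G s 0 = (s : ℂ) • hamiltonian G 1 0 := by
  simp only [hamiltonian, Complex.ofReal_zero, zero_smul, add_zero, Complex.ofReal_one, smul_smul,
    mul_neg_one]

omit [NeZero L] in
/-- `H^{t,t''}(U) = H^{t,t'}(U) + (t'' - t') T_d`, `T_d = hamiltonian (fermionTorusDiagGraph L) 1 0`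
the unit next-nearest-neighbour hopping operator. -/
theorem hubbardTorusTT'_eq_add_smul_diagHop (t' t'' U : ℝ) :
    hubbardTorusTT' L 1 t'' U = hubbardTorusTT' L 1 t' U +
      ((t'' - t' : ℝ) : ℂ) • hamiltonian (fermionTorusDiagGraph L) 1 0 := by
  rw [hubbardTorusTT', hubbardTorusTT', hamiltonian_zero_eq_smul _ t'',
    hamiltonian_zero_eq_smul _ t', Complex.ofReal_sub, sub_smul]
  abel

/-- **The thermal diagonal chord** (`U < 0`, `β > 0`, `m ≤ L²`, `p` a coordinate sector of
`2m`-particle occupation sets containing the fully paired ones, `N_p = dim p`, any real `s`,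
`τ' = 1 + |t' + s|`): `-s · Re⟨T_d|_p⟩_{β,p} ≤ 64 τ'² m/|U| + (log N_p)/β`. Peierls–Bogoliubov
in the direction `s T_d` (`H^{t,t'+s} = H^{t,t'} + s T_d`), `log Z_p(H^{t,t'}) ≥ -βUm`, and
`log Z_p(H^{t,t'+s}) ≤ log N_p - β(Um - 64τ'²m/|U|)` (entropy and the pair-breaking floor at
`a' = |U|/(8τ')` in the Gibbs state of `H^{t,t'+s}|_p`). -/
theorem neg_mul_re_gibbsState_diagHop_le (t' s : ℝ) {U β : ℝ} (hU : U < 0) (hβ : 0 < β)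
    {m : ℕ} (hm : m ≤ L ^ 2) (p : Finset (Orb (FermionTorus 2 L)) → Prop) [DecidablePred p]
    [Nonempty {a // p a}] (hpN : ∀ s, p s → s.card = 2 * m)
    (hpair : ∀ A : Finset (FermionTorus 2 L), A.card = m → p (pairSet A A)) :
    -(s * (gibbsState β ((hubbardTorusTT' L 1 t' U).toBlock p p)
        ((hamiltonian (fermionTorusDiagGraph L) 1 0).toBlock p p)).re) ≤
      64 * (1 + |t' + s|) ^ 2 * m / (-U) + Real.log (Fintype.card {a // p a}) / β := by
  set τ' : ℝ := 1 + |t' + s| with hτ'def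
  have hτ' : 0 < τ' := by positivity
  set a : ℝ := -U / (8 * τ') with ha
  have ha0 : 0 < a := div_pos (neg_pos.2 hU) (by positivity)
  obtain ⟨hω1, hωa⟩ := one_le_add_inv_and_le_sub_inv ha0
  set ω : ℝ := a + a⁻¹ with hωdef
  set D : Matrix (Finset (Orb (FermionTorus 2 L))) (Finset (Orb (FermionTorus 2 L))) ℂ :=
    ∑ x : FermionTorus 2 L, numberOp x 0 * numberOp x 1 with hD
  set Td : Matrix (Finset (Orb (FermionTorus 2 L))) (Finset (Orb (FermionTorus 2 L))) ℂ :=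
    hamiltonian (fermionTorusDiagGraph L) 1 0 with hTd
  set H := hubbardTorusTT' L 1 t' U with hH
  set Hs := hubbardTorusTT' L 1 (t' + s) U with hHs
  have hHp : (H.toBlock p p).IsHermitian := (hubbardTorusTT'_isHermitian L 1 t' U).submatrix _
  have hHsp : (Hs.toBlock p p).IsHermitian :=
    (hubbardTorusTT'_isHermitian L 1 (t' + s) U).submatrix _
  have hTdh : Td.IsHermitian :=
    (hamiltonian_isHermitian_and_commute_holds (fermionTorusDiagGraph L) 1 0).1
  have hZs : partitionFn β (Hs.toBlock p p) ≠ 0 := fun h =>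
    (partitionFn_re_pos hHsp β).ne' (by rw [h, Complex.zero_re])
  have hHs_eq : Hs = H + (s : ℂ) • Td := by
    rw [hHs, hH, hTd, hubbardTorusTT'_eq_add_smul_diagHop t' (t' + s) U, add_sub_cancel_left]
  -- (1) Peierls–Bogoliubov in the direction `s T_d`
  have hW : (((s : ℂ) • Td).toBlock p p).IsHermitian := (isHermitian_ofReal_smul hTdh s).submatrix _
  have hPB := log_partitionFn_sub_le_log_partitionFn_add hHp hW β
  have hsum : H.toBlock p p + ((s : ℂ) • Td).toBlock p p = Hs.toBlock p p := by
    rw [hHs_eq]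
    ext i j
    rfl
  have hWre : (gibbsState β (H.toBlock p p) (((s : ℂ) • Td).toBlock p p)).re =
      s * (gibbsState β (H.toBlock p p) (Td.toBlock p p)).re := by
    have e : ((s : ℂ) • Td).toBlock p p = (s : ℂ) • Td.toBlock p p := by
      ext i j
      rfl
    rw [e, map_smul, smul_eq_mul, Complex.re_ofReal_mul]
  rw [hsum, hWre] at hPB
  -- (2) `log Z_p(H) ≥ -β U m` (paired trial configuration)
  obtain ⟨A, -, hA⟩ := Finset.exists_subset_card_eq (n := m)
    (s := (Finset.univ : Finset (FermionTorus 2 L)))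
    (by rw [Finset.card_univ, NoGo.card_fermionTorus_two]; exact hm)
  have hE0 : (H.toBlock p p).groundEnergy ≤ U * m := by
    have h := groundEnergy_toBlock_le_re_apply (hubbardTorusTT'_isHermitian L 1 t' U) p
      (pairSet A A) (hpair A hA)
    rw [re_hubbardTorusTT'_apply_pairSet, hA] at h
    exact h
  have hZlow : -(β * (U * m)) ≤ Real.log (partitionFn β (H.toBlock p p)).re :=
    (Real.le_log_iff_exp_le (partitionFn_re_pos hHp β)).2
      ((Real.exp_le_exp.2 (by nlinarith)).trans (exp_neg_mul_groundEnergy_le_partitionFn hHp β))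
  -- (3) entropy: `log Z_p(Hs) + β Re⟨Hs⟩ ≤ log N_p`
  have hS := hHsp.gibbsEntropy_le_log_card β
  rw [gibbsEntropy_def] at hS
  -- (4) the floor in the Gibbs state of `Hs|_p`: `Re⟨Hs⟩ ≥ U m - 64 τ'² m/|U|`
  set c₂ : ℝ := U + 8 * τ' * (ω - ω⁻¹) with hc₂
  set c₁ : ℝ := 4 * ω * τ' * ((2 * m : ℕ) : ℝ) with hc₁
  have hd0 : 0 ≤ (gibbsState β (Hs.toBlock p p) (D.toBlock p p)).re :=
    (Complex.nonneg_iff.1 (gibbsState_nonneg_of_posSemidef β hHsp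
      ((posSemidef_doubleOcc (L := L)).submatrix (Subtype.val : {a // p a} → _)))).1
  have hc₂0 : 0 ≤ c₂ := by
    have e : 8 * τ' * a = -U := by
      rw [ha]
      field_simp
    nlinarith [mul_le_mul_of_nonneg_left hωa (by positivity : (0 : ℝ) ≤ 8 * τ')]
  have hfl : U * m - 64 * τ' ^ 2 * m / (-U) ≤
      (gibbsState β (Hs.toBlock p p) (Hs.toBlock p p)).re := by
    have hpsd : ((hubbardTorusTT' L 1 (t' + s) U - ((c₂ : ℝ) : ℂ) • D + ((c₁ : ℝ) : ℂ) • 1).toBlock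
        p p).PosSemidef :=
      posSemidef_toBlock_pairBreakingDefect (t' + s) U hω1 (2 * m) p hpN
    have h0 := gibbsState_nonneg_of_posSemidef β hHsp hpsd
    have hexp : (hubbardTorusTT' L 1 (t' + s) U - ((c₂ : ℝ) : ℂ) • D + ((c₁ : ℝ) : ℂ) • 1).toBlock
        p p = Hs.toBlock p p - ((c₂ : ℝ) : ℂ) • D.toBlock p p +
          ((c₁ : ℝ) : ℂ) • Matrix.toBlock 1 p p := by
      ext i j
      rfl
    rw [hexp, toBlock_one_self, map_add, map_sub, map_smul, map_smul, gibbsState_one β _ hZs] at h0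
    have h1 := (Complex.nonneg_iff.1 h0).1
    simp only [Complex.add_re, Complex.sub_re, smul_eq_mul, Complex.re_ofReal_mul, mul_one,
      Complex.ofReal_re] at h1
    have h5 := mul_nonneg hc₂0 hd0
    have hU0 : -U ≠ 0 := by linarith
    have key : c₁ = -(U * m) + 64 * τ' ^ 2 * m / (-U) := by
      rw [hc₁, hωdef, ha]
      push_cast
      field_simp
      ring
    rw [key] at h1
    linarith
  -- combine and divide by `β`
  have hβU : -(β * (s * (gibbsState β (H.toBlock p p) (Td.toBlock p p)).re)) ≤
      Real.log (Fintype.card {a // p a}) + β * (64 * τ' ^ 2 * m / (-U)) := by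
    nlinarith
  have key : β * -(s * (gibbsState β (H.toBlock p p) (Td.toBlock p p)).re) ≤
      β * (64 * τ' ^ 2 * m / (-U) + Real.log (Fintype.card {a // p a}) / β) := by
    have e : β * (Real.log (Fintype.card {a // p a}) / β) = Real.log (Fintype.card {a // p a}) := by
      field_simp
    rw [mul_add, e]
    linarith
  exact le_of_mul_le_mul_left key hβ

/-- **The diagonal weight of a sector Gibbs state, `t–t'` class, `T > 0`** (chord at
`s = ±τ`, `τ = 1 + |t'|`, `1 + |t' ± τ| = 2τ`):
`-t' Re⟨T_d|_p⟩_{β,p} ≤ |t'| (256 τ m/|U| + (log N_p)/(τβ))`. -/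
theorem neg_tPrime_mul_re_gibbsState_diagHop_le (t' : ℝ) {U β : ℝ} (hU : U < 0) (hβ : 0 < β)
    {m : ℕ} (hm : m ≤ L ^ 2) (p : Finset (Orb (FermionTorus 2 L)) → Prop) [DecidablePred p]
    [Nonempty {a // p a}] (hpN : ∀ s, p s → s.card = 2 * m)
    (hpair : ∀ A : Finset (FermionTorus 2 L), A.card = m → p (pairSet A A)) :
    -(t' * (gibbsState β ((hubbardTorusTT' L 1 t' U).toBlock p p)
        ((hamiltonian (fermionTorusDiagGraph L) 1 0).toBlock p p)).re) ≤
      |t'| * (256 * (1 + |t'|) * m / (-U) +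
        Real.log (Fintype.card {a // p a}) / ((1 + |t'|) * β)) := by
  set x : ℝ := (gibbsState β ((hubbardTorusTT' L 1 t' U).toBlock p p)
    ((hamiltonian (fermionTorusDiagGraph L) 1 0).toBlock p p)).re with hx
  have hτ : 0 < 1 + |t'| := by positivity
  have hV : 0 < -U := neg_pos.2 hU
  have e : 256 * (1 + |t'|) * m / (-U) + Real.log (Fintype.card {a // p a}) / ((1 + |t'|) * β) =
      (64 * (2 * (1 + |t'|)) ^ 2 * m / (-U) + Real.log (Fintype.card {a // p a}) / β) /
        (1 + |t'|) := by
    field_simp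
    ring
  rcases le_or_gt 0 t' with ht | ht
  · have h := neg_mul_re_gibbsState_diagHop_le t' (1 + |t'|) hU hβ hm p hpN hpair
    rw [← hx] at h
    have habs : 1 + |t' + (1 + |t'|)| = 2 * (1 + |t'|) := by
      rw [abs_of_nonneg (by linarith [abs_nonneg t'] : (0 : ℝ) ≤ t' + (1 + |t'|))]
      linarith [abs_of_nonneg ht]
    rw [habs] at h
    have hdiv : -x ≤ 256 * (1 + |t'|) * m / (-U) +
        Real.log (Fintype.card {a // p a}) / ((1 + |t'|) * β) := by
      rw [e, le_div_iff₀ hτ]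
      linarith
    rw [show t' * x = |t'| * x by rw [abs_of_nonneg ht]]
    nlinarith [mul_le_mul_of_nonneg_left hdiv (abs_nonneg t')]
  · have h := neg_mul_re_gibbsState_diagHop_le t' (-(1 + |t'|)) hU hβ hm p hpN hpair
    rw [← hx] at h
    have habs : 1 + |t' + -(1 + |t'|)| = 2 * (1 + |t'|) := by
      rw [abs_of_neg (by linarith [abs_nonneg t'] : t' + -(1 + |t'|) < 0)]
      linarith [abs_of_neg ht]
    rw [habs] at h
    have hdiv : x ≤ 256 * (1 + |t'|) * m / (-U) +
        Real.log (Fintype.card {a // p a}) / ((1 + |t'|) * β) := by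
      rw [e, le_div_iff₀ hτ]
      linarith
    rw [show t' * x = -(|t'| * x) by rw [abs_of_neg ht]; ring, neg_neg]
    exact mul_le_mul_of_nonneg_left hdiv (abs_nonneg t')

/-! ### The thermal stiffness ceiling, `t–t'` class -/

/-- **Thm 9(vi) at `T > 0`** (`L ≥ 3`, `U < 0`, `β, ρ_s, θ₀ > 0`, `m ≤ L²`, `τ = 1 + |t'|`, `p`
the `(2m, S^z = 0)` coordinate sector, `N_p = dim p`): if the sector free energy of
`hubbardTorusTT'Flux L t' U θ` is stiff in the flux, `β ρ_s θ² ≤ log Z_p(0) - log Z_p(θ)` on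
`|θ| ≤ θ₀`, then `ρ_s L² ≤ 64 τ(1 + 2|t'|) m/|U| + (1 + 2|t'|)(log N_p)/(4τβ)`. -/
theorem thermalStiffness_mul_sq_le_attractive_density (hL : 3 ≤ L) (t' : ℝ) {U β ρs θ₀ : ℝ}
    (hU : U < 0) (hβ : 0 < β) (hρs : 0 < ρs) (hθ₀ : 0 < θ₀) {m : ℕ} (hm : m ≤ L ^ 2)
    (hstiff : ∀ θ : ℝ, |θ| ≤ θ₀ → β * ρs * θ ^ 2 ≤
      Real.log (partitionFn β ((hubbardTorusTT'Flux L t' U 0).toBlock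
        (fun s : Finset (Orb (FermionTorus 2 L)) =>
          s.card = 2 * m ∧ 2 * (s.filter fun i => (ofLex i).2 = 0).card = 2 * m)
        (fun s => s.card = 2 * m ∧ 2 * (s.filter fun i => (ofLex i).2 = 0).card = 2 * m))).re -
      Real.log (partitionFn β ((hubbardTorusTT'Flux L t' U θ).toBlock
        (fun s : Finset (Orb (FermionTorus 2 L)) =>
          s.card = 2 * m ∧ 2 * (s.filter fun i => (ofLex i).2 = 0).card = 2 * m)
        (fun s => s.card = 2 * m ∧ 2 * (s.filter fun i => (ofLex i).2 = 0).card = 2 * m))).re) :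
    ρs * (L : ℝ) ^ 2 ≤ 64 * (1 + |t'|) * (1 + 2 * |t'|) * m / (-U) +
      (1 + 2 * |t'|) * Real.log (Fintype.card {s : Finset (Orb (FermionTorus 2 L)) //
        s.card = 2 * m ∧ 2 * (s.filter fun i => (ofLex i).2 = 0).card = 2 * m}) /
        (4 * (1 + |t'|) * β) := by
  set p : Finset (Orb (FermionTorus 2 L)) → Prop := fun s =>
    s.card = 2 * m ∧ 2 * (s.filter fun i => (ofLex i).2 = 0).card = 2 * m with hp
  haveI : Nonempty {a // p a} := nonempty_spinZeroSector (L := L) hm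
  have hpN : ∀ s, p s → s.card = 2 * m := fun s hs => hs.1
  have hpair : ∀ A : Finset (FermionTorus 2 L), A.card = m → p (pairSet A A) := fun A hA =>
    pairSet_mem_spinZeroSector A hA
  have hfloor := thermalStiffnessTT'_mul_sq_le_kinetic hL t' U hβ hρs hθ₀ p hstiff
  have hrot := two_mul_re_gibbsState_kinOpTT'_le hL t' U β p
    (fun s t h => sector_iff_of_fockMapOp_rot_ne_zero _ h)
  have hkin := neg_re_gibbsState_hopping_le_attractive_density t' hU hβ hm p hpN hpair
  have hdiag := neg_tPrime_mul_re_gibbsState_diagHop_le t' hU hβ hm p hpN hpair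
  -- `-⟨H^{t,2t'}(0)|_p⟩ = -⟨H^{t,t'}(0)|_p⟩ - t' ⟨T_d|_p⟩`
  have hsplit : (gibbsState β ((hubbardTorusTT' L 1 t' U).toBlock p p)
      ((hubbardTorusTT' L 1 (2 * t') 0).toBlock p p)).re =
      (gibbsState β ((hubbardTorusTT' L 1 t' U).toBlock p p)
        ((hubbardTorusTT' L 1 t' 0).toBlock p p)).re +
      t' * (gibbsState β ((hubbardTorusTT' L 1 t' U).toBlock p p)
        ((hamiltonian (fermionTorusDiagGraph L) 1 0).toBlock p p)).re := by
    have e : (hubbardTorusTT' L 1 (2 * t') 0).toBlock p p = (hubbardTorusTT' L 1 t' 0).toBlock p p +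
        (t' : ℂ) • (hamiltonian (fermionTorusDiagGraph L) 1 0).toBlock p p := by
      rw [hubbardTorusTT'_eq_add_smul_diagHop t' (2 * t') 0, show (2 * t' - t' : ℝ) = t' by ring]
      ext i j
      rfl
    rw [e, map_add, map_smul, Complex.add_re, smul_eq_mul, Complex.re_ofReal_mul]
  have hτ : 0 < 1 + |t'| := by positivity
  have hV : 0 < -U := neg_pos.2 hU
  have e : 64 * (1 + |t'|) * (1 + 2 * |t'|) * m / (-U) +
      (1 + 2 * |t'|) * Real.log (Fintype.card {a // p a}) / (4 * (1 + |t'|) * β) =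
      (256 * (1 + |t'|) ^ 2 * m / (-U) + Real.log (Fintype.card {a // p a}) / β +
        |t'| * (256 * (1 + |t'|) * m / (-U) +
          Real.log (Fintype.card {a // p a}) / ((1 + |t'|) * β))) / 4 := by
    field_simp
    ring
  rw [e]
  linarith

/-- **Thm 9(vi) at `T > 0` (thermal density-proportional stiffness ceiling, `t–t'` class; PROVED
below).** `L ≥ 3`, any real `t'`, `U < 0`, `δ ≥ -1`, `β, ρ_s, θ₀ > 0`, `τ = 1 + |t'|`,
`N_L = 2⌊(1-δ)L²/2⌋`, `p` the `(N_L, S^z = 0)` coordinate sector, `N_p = dim p`: if the sector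
free energy of `hubbardTorusTT'Flux L t' U θ` is stiff in the flux,
`β ρ_s θ² ≤ log Z_p(0) - log Z_p(θ)` on `|θ| ≤ θ₀`, then
`ρ_s L² ≤ 64 τ(1+2|t'|) ⌊(1-δ)L²/2⌋/|U| + (1+2|t'|)(log N_p)/(4τβ)` (`log N_p ≤ 2L² log 2`).
kind: support (PROVED). Why it might fail: it cannot; informative only for `T ≲ t²/|U|`, dilute.
Sources: ScalapinoWhiteZhang1993 §II; ParamekantiTrivediRanderia1998 eq. (3);
HazraVermaRanderia2019 §III, App. G; XuEtAl2024 eq. (1); this cell (Thm 9(i)–(vi)). -/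
@[conjecture] def ThermalAttractiveStiffnessCeilingDensityTT' : Prop :=
  ∀ (L : ℕ) [NeZero L], 3 ≤ L → ∀ (t' U δ β ρs θ₀ : ℝ), U < 0 → -1 ≤ δ → 0 < β → 0 < ρs →
    0 < θ₀ →
    let p : Finset (Orb (FermionTorus 2 L)) → Prop := fun s =>
      s.card = 2 * ⌊(1 - δ) * (L : ℝ) ^ 2 / 2⌋₊ ∧
        2 * (s.filter fun i => (ofLex i).2 = 0).card = 2 * ⌊(1 - δ) * (L : ℝ) ^ 2 / 2⌋₊
    (∀ θ : ℝ, |θ| ≤ θ₀ → β * ρs * θ ^ 2 ≤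
        Real.log (partitionFn β ((hubbardTorusTT'Flux L t' U 0).toBlock p p)).re -
          Real.log (partitionFn β ((hubbardTorusTT'Flux L t' U θ).toBlock p p)).re) →
    ρs * (L : ℝ) ^ 2 ≤
      64 * (1 + |t'|) * (1 + 2 * |t'|) * (⌊(1 - δ) * (L : ℝ) ^ 2 / 2⌋₊ : ℝ) / (-U) +
        (1 + 2 * |t'|) * Real.log (Fintype.card {s // p s}) / (4 * (1 + |t'|) * β)

/-- **`ThermalAttractiveStiffnessCeilingDensityTT'` holds.** -/
theorem thermalAttractiveStiffnessCeilingDensityTT'_holds :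
    ThermalAttractiveStiffnessCeilingDensityTT' := by
  intro L _ hL t' U δ β ρs θ₀ hU hδ hβ hρs hθ₀
  dsimp only; intro hst
  exact thermalStiffness_mul_sq_le_attractive_density hL t' hU hβ hρs hθ₀
    (NoGo.floor_pairNumber_le δ hδ L) hst

/-- **Thm 9(iii) at `T > 0` (PROVED below): the case `t' = 0`** (pure Hubbard torus, `x`-seam
twist `hubbardTorusTT'Flux L 0 U θ`): flux stiffness of the `(N_L, S^z = 0)` sector free energy
`⟹ ρ_s L² ≤ 64 ⌊(1-δ)L²/2⌋/|U| + (log N_p)/(4β)`, i.e. `ρ_s ≤ 32 n t²/|U| + T log N_p/(4L²)`.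
kind: support (PROVED). Why it might fail: it cannot. Sources: as the `t–t'` node. -/
@[conjecture] def ThermalAttractiveStiffnessCeilingDensity : Prop :=
  ∀ (L : ℕ) [NeZero L], 3 ≤ L → ∀ (U δ β ρs θ₀ : ℝ), U < 0 → -1 ≤ δ → 0 < β → 0 < ρs → 0 < θ₀ →
    let p : Finset (Orb (FermionTorus 2 L)) → Prop := fun s =>
      s.card = 2 * ⌊(1 - δ) * (L : ℝ) ^ 2 / 2⌋₊ ∧
        2 * (s.filter fun i => (ofLex i).2 = 0).card = 2 * ⌊(1 - δ) * (L : ℝ) ^ 2 / 2⌋₊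
    (∀ θ : ℝ, |θ| ≤ θ₀ → β * ρs * θ ^ 2 ≤
        Real.log (partitionFn β ((hubbardTorusTT'Flux L 0 U 0).toBlock p p)).re -
          Real.log (partitionFn β ((hubbardTorusTT'Flux L 0 U θ).toBlock p p)).re) →
    ρs * (L : ℝ) ^ 2 ≤
      64 * (⌊(1 - δ) * (L : ℝ) ^ 2 / 2⌋₊ : ℝ) / (-U) + Real.log (Fintype.card {s // p s}) / (4 * β)

/-- **`ThermalAttractiveStiffnessCeilingDensity` holds** (the `t–t'` theorem at `t' = 0`). -/
theorem thermalAttractiveStiffnessCeilingDensity_holds :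
    ThermalAttractiveStiffnessCeilingDensity := by
  intro L _ hL U δ β ρs θ₀ hU hδ hβ hρs hθ₀
  dsimp only; intro hst
  have h := thermalStiffness_mul_sq_le_attractive_density hL 0 hU hβ hρs hθ₀
    (NoGo.floor_pairNumber_le δ hδ L) hst
  simp only [abs_zero, add_zero, mul_zero, mul_one, one_mul] at h
  exact h

end Summit.HubbardSuperconductivity.HubbardLadder.Bounds

end
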